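import Summits.SmoothPoincare4.SmoothPoincare4.Theses.DottedCircleRasmussen

/-!
# SmoothPoincare4 / DottedCircleRasmussen — assembly

Settles item stmt-SmoothPoincare4-17012 (assembly of route DottedCircleRasmussen, rev 2):
`DcrGap → ¬ SmoothPoincare4`.

Pure logic.  The one-handle slice gap `DcrGap` provides `k`, a model circle `K₀ ⊂ ∂D_k`, a homotopy
4-sphere `M` (Hausdorff, second countable, a `C^∞` atlas on `ℝ⁴`, `M ≃ₕ S⁴`) with a smooth
embedding `e : ℝ⁴ → M` and a smooth proper disc `f` in `M ∖ e(D_k)` bounded by `e ∘ K₀`, together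
with the clause that NO smooth 4-manifold `N` diffeomorphic to `S⁴` carries such a datum.
`SmoothPoincare4` (`= Literature.SPC4.SmoothPoincareConjectureFour.{0}`, Mathlib's
`HomotopyEquiv.NonemptyDiffeomorphSphere M 4` closed over all admissible `M`) makes `M` itself such
an `N`, and `(e, f)` contradicts the clause.  This is exactly the route file's own deciding theorem
`DottedCircleRasmussen.closes`; nothing else is used (no named facts).
-/

-- the registered namespace `Summit.SmoothPoincare4.SmoothPoincare4.Theorems` repeats a component
set_option linter.dupNamespace false

namespace Summit.SmoothPoincare4.SmoothPoincare4.Theorems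

open Summit.SmoothPoincare4.SmoothPoincare4.Theses.DottedCircleRasmussen

/-- Settles stmt-SmoothPoincare4-17012: the assembly `DcrGap → ¬ SmoothPoincare4` of route
DottedCircleRasmussen.  Proof: apply the route's deciding theorem `DottedCircleRasmussen.closes`
(from `DcrGap` take the witness `(k, K₀, M, e, f)` and the no-disc clause over all `N ≅ S⁴`;
`SmoothPoincare4` gives `Nonempty (M ≃ₘ S⁴)` for the witnessing atlas, so `M` is an admissible `N`
and `(e, f)` contradicts the clause). [folklore] -/
theorem DottedCircleRasmussen_Assembly_proof :
    Summit.SmoothPoincare4.SmoothPoincare4.Theses.DottedCircleRasmussen.Assembly := by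
  unfold Assembly
  intro hX
  exact closes hX

end Summit.SmoothPoincare4.SmoothPoincare4.Theorems
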